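import Mathlib

/-!
# P5AprimeCensus — the balanced subsets of `(ℤ/96)^×` for the CM type `T′` of the sixteenfold `A′`, kernel-checked

p5 (g21), 2026-08-29.  Supporting artefact (R-5): finite combinatorics only; nothing here is an algebraicity statement.
The objects are subsets of the 32 units of `ℤ/96`, the CM type `T′ = {13,19,29,31,35,41,49,53,59,71,73,79,85,89,91,95}`
of the simple CM sixteenfold `A′` (the page of Theorem F′, proofs/P1-HCofAprime-v1.md §2; the census of rev-1 (g25)
STATUS l.8222 and rev-2 (g27) l.8364), and integer signatures.

A subset `S` of the units is BALANCED if for every unit `k` exactly half of `S` is carried into `T′` by multiplication by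
`k` (`Balanced`).  THEOREM (`balanced_iff_blocks`): `S` is balanced iff on each of the four blocks `cH ∪ −cH`
(`H = {1,25,49,73} = ker((ℤ/96)^× → (ℤ/24)^×)`, `c ∈ {1,5,7,11}`) the function `n_S(t) = [t ∈ S] − [−t ∈ S]` is constant
on the coset `cH` — i.e. `S ∩ (cH ∪ −cH)` is a union of conjugate pairs `{t, −t}` (`n ≡ 0`), or the coset `cH` (`n ≡ 1`),
or the coset `−cH` (`n ≡ −1`).  The companion files draw the consequences: every balanced set is a disjoint union of
conjugate pairs and cosets of `H` and the PRIMITIVE balanced sets are exactly the 16 pairs and the 8 cosets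
(`P5AprimeCensusPieces.lean`: `balanced_decomposition`, `primitive_iff`); the balanced sets number `18⁴ = 104976`
(`P5AprimeCensusCount.lean`: `card_balanced`).

THE METHOD (no enumeration of the `2³²` subsets): balance is linear — `S` is balanced iff the signature
`sig S k = Σ_{s ∈ S} ε(k s)` vanishes for all units `k`, where `ε = 2·1_{T′} − 1` (`balanced_iff_sig`).  Since `T′` is a CM
type, `ε(k s) + ε(k (−s)) = 0` (`eps_conj`), so `sig S k = Σ_{t ∈ R} n_S(t) ε(k t)` over the 16 pair representatives
`R = H ∪ 5H ∪ 7H ∪ 11H` (`sig_eq_sum_R`).  TWELVE integer functionals `q_j` on the 32 units (`qtab`; three per coset,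
each with `Σ_k q_j(k) ε(k t) = 12` at one representative, `−12` at the next one of the same coset and `0` at the other
fourteen — the table `w_table`, a `decide`) force `n_S` to be constant on each coset (`n_const_of_balanced`); the converse
uses that every coset of `H` is balanced (`coset_sig`).

ENCODING: units and types are `List ℕ` / `Finset ℕ` of residues in `[0, 96)`; the conjugate of `u` is `conj u = 96 − u`;
`coset c = [c, 25c, 49c, 73c] mod 96`; functionals are association lists `(unit, value)` read with `List.lookup`.
-/

namespace HodgeRepro0.P5AprimeCensus

/-- The 32 units of `ℤ/96`, increasing. -/
def units : List ℕ :=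
  [1, 5, 7, 11, 13, 17, 19, 23, 25, 29, 31, 35, 37, 41, 43, 47, 49, 53, 55, 59, 61, 65, 67, 71, 73, 77, 79, 83, 85,
    89, 91, 95]

/-- The CM type `T′ ⊂ (ℤ/96)^×` of the simple CM sixteenfold `A′` (the page of Theorem C / Theorem F′). -/
def Tp : List ℕ := [13, 19, 29, 31, 35, 41, 49, 53, 59, 71, 73, 79, 85, 89, 91, 95]

/-- `ε(u) = 1` if `u mod 96 ∈ T′`, `−1` otherwise. -/
def eps (u : ℕ) : ℤ := if u % 96 ∈ Tp then 1 else -1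

/-- The conjugate of a residue: `u ↦ 96 − u` (`= −u mod 96` on units). -/
def conj (u : ℕ) : ℕ := 96 - u

/-- The coset `cH` of `H = {1, 25, 49, 73}` through `c`, listed as `[c, 25c, 49c, 73c]`. -/
def coset (c : ℕ) : List ℕ := [c % 96, (25 * c) % 96, (49 * c) % 96, (73 * c) % 96]

/-- The four coset representatives `1, 5, 7, 11`: the cosets `H, 5H, 7H, 11H` are pairwise non-conjugate and
together with their conjugates `−H, −5H, −7H, −11H` partition the units. -/
def creps : List ℕ := [1, 5, 7, 11]

/-- The 16 pair representatives: the cosets `H, 5H, 7H, 11H` in the order of `coset`. -/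
def R : List ℕ := [1, 25, 49, 73, 5, 29, 53, 77, 7, 79, 55, 31, 11, 83, 59, 35]

/-- The units as a finset. -/
def U : Finset ℕ := units.toFinset

/-- The pair representatives as a finset. -/
def Rf : Finset ℕ := R.toFinset

/-- The signature of `S` at `k`: `Σ_{s ∈ S} ε(k s)`. -/
def sig (S : Finset ℕ) (k : ℕ) : ℤ := ∑ s ∈ S, eps (k * s)

/-- BALANCED: for every unit `k`, multiplication by `k` carries exactly half of `S` into `T′`
(`|kS ∩ T′| = |S|/2`, the Pohlmann / Weil criterion for the line `L_S` to be a Hodge class on every conjugate). -/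
abbrev Balanced (S : Finset ℕ) : Prop :=
  ∀ k ∈ units, 2 * (S.filter (fun s => (k * s) % 96 ∈ Tp)).card = S.card

/-- `n_S(t) = [t ∈ S] − [conj t ∈ S]`. -/
def nS (S : Finset ℕ) (t : ℕ) : ℤ := (if t ∈ S then 1 else 0) - (if conj t ∈ S then 1 else 0)

/-- The twelve separating functionals, as association lists `(unit, value)` on the first twelve units; functional
`j` separates the representatives `R[4(j/3) + j%3]` and `R[4(j/3) + j%3 + 1]` (the same coset). -/
def qtab : List (List (ℕ × ℤ)) :=
  [[(1, 0), (5, -4), (7, -4), (11, -2), (13, 3), (17, -1), (19, 1), (23, 1), (25, 1), (29, -3), (31, 1), (35, 1)],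
   [(1, 2), (5, -2), (7, 0), (11, -4), (13, 1), (17, 1), (19, 3), (23, -1), (25, 1), (29, 1), (31, -5), (35, -3)],
   [(1, 0), (5, 4), (7, 4), (11, 2), (13, -3), (17, -5), (19, -1), (23, -1), (25, -1), (29, 3), (31, 5), (35, -1)],
   [(1, -4), (5, 2), (7, 4), (11, 4), (13, -5), (17, -1), (19, -1), (23, 1), (25, -3), (29, 1), (31, 3), (35, 5)],
   [(1, -2), (5, 0), (7, -2), (11, 0), (13, 5), (17, 3), (19, -1), (23, 3), (25, 1), (29, -1), (31, 1), (35, -1)],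
   [(1, 4), (5, -2), (7, -4), (11, -4), (13, -1), (17, 1), (19, 1), (23, -1), (25, 3), (29, -1), (31, -3), (35, 1)],
   [(1, -4), (5, 4), (7, 0), (11, 2), (13, 1), (17, 1), (19, -3), (23, -1), (25, 1), (29, 1), (31, 1), (35, 3)],
   [(1, 0), (5, -2), (7, -2), (11, -4), (13, 3), (17, 1), (19, -1), (23, 5), (25, -1), (29, -3), (31, -1), (35, -1)],
   [(1, 4), (5, -4), (7, 0), (11, -2), (13, -1), (17, -1), (19, 3), (23, -5), (25, 5), (29, -1), (31, -1), (35, -3)],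
   [(1, -2), (5, 4), (7, 2), (11, 2), (13, -1), (17, 1), (19, -5), (23, -1), (25, -3), (29, 5), (31, 3), (35, 1)],
   [(1, -4), (5, 0), (7, -4), (11, 0), (13, 1), (17, 3), (19, 1), (23, 3), (25, -1), (29, -5), (31, -1), (35, 1)],
   [(1, 2), (5, -4), (7, -2), (11, -2), (13, 1), (17, -1), (19, -1), (23, 1), (25, 3), (29, 1), (31, -3), (35, -1)]]

/-- The value of functional `j` at the unit `k` (`0` outside its support). -/
def qval (j k : ℕ) : ℤ := ((qtab.getD j []).lookup k).getD 0

/-- The source representative of functional `j`. -/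
def src (j : ℕ) : ℕ := R.getD (4 * (j / 3) + j % 3) 0

/-- The destination representative of functional `j` (the next element of the same coset). -/
def dst (j : ℕ) : ℕ := R.getD (4 * (j / 3) + j % 3 + 1) 0

/-- The pairing of functional `j` with the vector `(ε(k t))_k`, as a list sum. -/
def wL (j t : ℕ) : ℤ := (units.map (fun k => qval j k * eps (k * t))).sum

/-- The pairing of functional `j` with the vector `(ε(k t))_k`, as a finset sum over `U`. -/
def w (j t : ℕ) : ℤ := ∑ k ∈ U, qval j k * eps (k * t)

/-! ### The finite facts, by `decide` -/

/-- `T′` is a CM type: for every unit `u`, exactly one of `u`, `−u` lies in `T′`; hence `ε(k s) + ε(k · conj s) = 0`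
for all units `k`, `s`. -/
theorem eps_conj : ∀ k ∈ units, ∀ s ∈ units, eps (k * s) + eps (k * conj s) = 0 := by
  decide +kernel

/-- The table of the twelve functionals: `w_j(t) = 12` at `src j`, `−12` at `dst j`, `0` at every other
representative. -/
theorem w_table : ∀ j < 12, ∀ t ∈ R,
    wL j t = if t = src j then 12 else if t = dst j then -12 else 0 := by
  decide +kernel

/-- Every coset `cH`, `c ∈ {1,5,7,11}`, is balanced: `Σ_{t ∈ cH} ε(k t) = 0` for every unit `k`. -/
theorem coset_sig : ∀ c ∈ creps, ∀ k ∈ units, ((coset c).map (fun t => eps (k * t))).sum = 0 := by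
  decide +kernel

/-- `src j` and `dst j` lie in `R` and differ, for `j < 12`. -/
theorem src_dst : ∀ j < 12, src j ∈ R ∧ dst j ∈ R ∧ src j ≠ dst j := by
  decide +kernel

/-- The representatives are units, and the units are the representatives together with their conjugates. -/
theorem R_facts : R.Nodup ∧ units.Nodup ∧ (∀ t ∈ R, t ∈ units) ∧ (∀ t ∈ R, t < 96) ∧
    (∀ t ∈ R, conj t ∉ R) ∧ (∀ u ∈ units, u ∈ R ∨ ∃ t ∈ R, u = conj t) := by
  decide +kernel

/-- `R` is the concatenation of the four cosets of `creps`. -/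
theorem R_eq_cosets : R = (creps.map coset).flatten := by
  decide +kernel

/-! ### Balance is linear -/

/-- `sig S k = 2·|{s ∈ S : k s mod 96 ∈ T′}| − |S|`. -/
theorem sig_eq (S : Finset ℕ) (k : ℕ) :
    sig S k = 2 * ((S.filter (fun s => (k * s) % 96 ∈ Tp)).card : ℤ) - (S.card : ℤ) := by
  have h1 : ∀ s, eps (k * s) = 2 * (if (k * s) % 96 ∈ Tp then (1 : ℤ) else 0) - 1 := by
    intro s; unfold eps; split_ifs <;> simp
  unfold sig
  simp_rw [h1]
  rw [Finset.sum_sub_distrib, ← Finset.mul_sum, Finset.sum_boole, Finset.sum_const]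
  simp

/-- BALANCED ⟺ every signature vanishes. -/
theorem balanced_iff_sig (S : Finset ℕ) : Balanced S ↔ ∀ k ∈ units, sig S k = 0 := by
  unfold Balanced
  constructor
  · intro h k hk
    rw [sig_eq]
    have := h k hk
    omega
  · intro h k hk
    have := h k hk
    rw [sig_eq] at this
    omega

/-! ### The pair representatives -/

/-- The units are the representatives and their conjugates. -/
theorem U_eq : U = Rf ∪ Rf.image conj := by decide +kernel

/-- Representatives and conjugates are disjoint. -/
theorem Rf_disj : Disjoint Rf (Rf.image conj) := by decide +kernel

/-- `conj` is injective on the representatives. -/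
theorem conj_inj : ∀ x ∈ Rf, ∀ y ∈ Rf, conj x = conj y → x = y := by decide +kernel

/-- Every representative is a unit. -/
theorem Rf_sub_U : ∀ t ∈ Rf, t ∈ units := by decide +kernel

/-- A sum over the units is a sum over the representatives of the pair terms. -/
theorem sum_pairs (f : ℕ → ℤ) : ∑ s ∈ U, f s = ∑ t ∈ Rf, (f t + f (conj t)) := by
  rw [U_eq, Finset.sum_union Rf_disj, Finset.sum_image conj_inj, Finset.sum_add_distrib]

/-- The pair term of `S` at a representative `t`: `[t ∈ S] ε(k t) + [conj t ∈ S] ε(k conj t) = n_S(t) ε(k t)`. -/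
theorem pair_term (S : Finset ℕ) (k : ℕ) (hk : k ∈ units) (t : ℕ) (ht : t ∈ units) :
    (if t ∈ S then eps (k * t) else 0) + (if conj t ∈ S then eps (k * conj t) else 0) =
      nS S t * eps (k * t) := by
  have h := eps_conj k hk t ht
  unfold nS
  split_ifs <;> linarith

/-- For `S ⊆ U`: `sig S k = Σ_{t ∈ R} n_S(t) ε(k t)`. -/
theorem sig_eq_sum_R (S : Finset ℕ) (hS : S ⊆ U) (k : ℕ) (hk : k ∈ units) :
    sig S k = ∑ t ∈ Rf, nS S t * eps (k * t) := by
  have hS' : S = U.filter (fun s => s ∈ S) := by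
    rw [Finset.filter_mem_eq_inter, Finset.inter_eq_right.mpr hS]
  unfold sig
  conv_lhs => rw [hS']
  rw [Finset.sum_filter, sum_pairs]
  apply Finset.sum_congr rfl
  intro t ht
  exact pair_term S k hk t (Rf_sub_U t ht)

/-! ### The functionals -/

/-- The finset form of the pairing equals the list form. -/
theorem w_eq_wL (j t : ℕ) : w j t = wL j t := by
  unfold w wL U
  rw [List.sum_toFinset _ R_facts.2.1]

/-- The table of the twelve functionals, in the finset form. -/
theorem w_val : ∀ j < 12, ∀ t ∈ Rf,
    w j t = if t = src j then 12 else if t = dst j then -12 else 0 := by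
  intro j hj t ht
  rw [w_eq_wL]
  exact w_table j hj t (List.mem_toFinset.mp ht)

/-- Pairing a functional with the signatures of `S ⊆ U`: `Σ_k q_j(k) sig S k = Σ_{t ∈ R} n_S(t) w_j(t)`. -/
theorem dot_eq (S : Finset ℕ) (hS : S ⊆ U) (j : ℕ) :
    ∑ k ∈ U, qval j k * sig S k = ∑ t ∈ Rf, nS S t * w j t := by
  unfold w
  calc ∑ k ∈ U, qval j k * sig S k
      = ∑ k ∈ U, ∑ t ∈ Rf, qval j k * (nS S t * eps (k * t)) := by
        apply Finset.sum_congr rfl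
        intro k hk
        rw [sig_eq_sum_R S hS k (List.mem_toFinset.mp hk), Finset.mul_sum]
    _ = ∑ t ∈ Rf, ∑ k ∈ U, nS S t * (qval j k * eps (k * t)) := by
        rw [Finset.sum_comm]
        apply Finset.sum_congr rfl; intro t _; apply Finset.sum_congr rfl; intro k _; ring
    _ = ∑ t ∈ Rf, nS S t * ∑ k ∈ U, qval j k * eps (k * t) := by
        apply Finset.sum_congr rfl; intro t _; rw [Finset.mul_sum]

/-- `Σ_{t ∈ R} n_S(t) w_j(t) = 12 (n_S(src j) − n_S(dst j))`. -/
theorem sum_nw (S : Finset ℕ) (j : ℕ) (hj : j < 12) :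
    ∑ t ∈ Rf, nS S t * w j t = 12 * (nS S (src j) - nS S (dst j)) := by
  obtain ⟨hsrc, hdst, hne⟩ := src_dst j hj
  have hsrc' : src j ∈ Rf := List.mem_toFinset.mpr hsrc
  have hdst' : dst j ∈ Rf := List.mem_toFinset.mpr hdst
  calc ∑ t ∈ Rf, nS S t * w j t
      = ∑ t ∈ Rf, ((if t = src j then 12 * nS S t else 0) + (if t = dst j then -12 * nS S t else 0)) := by
        apply Finset.sum_congr rfl
        intro t ht
        rw [w_val j hj t ht]
        by_cases h1 : t = src j
        · subst h1
          simp only [ite_true, if_neg hne, add_zero]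
          ring
        · by_cases h2 : t = dst j
          · subst h2
            simp only [ite_true, if_neg h1, zero_add]
            ring
          · simp only [if_neg h1, if_neg h2, mul_zero, add_zero]
    _ = 12 * (nS S (src j) - nS S (dst j)) := by
        rw [Finset.sum_add_distrib, Finset.sum_ite_eq', Finset.sum_ite_eq']
        simp [hsrc', hdst']
        ring

/-- A balanced `S ⊆ U` has `n_S(src j) = n_S(dst j)` for each functional `j`. -/
theorem n_src_dst (S : Finset ℕ) (hS : S ⊆ U) (hb : Balanced S) : ∀ j < 12, nS S (src j) = nS S (dst j) := by
  intro j hj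
  have h0 : ∑ k ∈ U, qval j k * sig S k = 0 := by
    apply Finset.sum_eq_zero
    intro k hk
    rw [(balanced_iff_sig S).mp hb k (List.mem_toFinset.mp hk), mul_zero]
  rw [dot_eq S hS j, sum_nw S j hj] at h0
  linarith

/-- The four cosets in terms of `src` / `dst`: `src (3i + a) = (coset c_i)[a]` and `dst (3i + a) = (coset c_i)[a+1]`. -/
theorem coset_src_dst : ∀ i < 4, ∀ a < 3,
    src (3 * i + a) = (coset (creps.getD i 0)).getD a 0 ∧ dst (3 * i + a) = (coset (creps.getD i 0)).getD (a + 1) 0 := by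
  decide +kernel

/-- Membership in a coset list is by position. -/
theorem coset_mem : ∀ c ∈ creps, ∀ t ∈ coset c, ∃ a < 4, t = (coset c).getD a 0 := by
  decide +kernel

/-- Each `c ∈ creps` is the first element of its coset. -/
theorem coset_head : ∀ c ∈ creps, (coset c).getD 0 0 = c := by decide +kernel

/-- `creps` membership is by position. -/
theorem creps_mem : ∀ c ∈ creps, ∃ i < 4, c = creps.getD i 0 := by decide +kernel

/-- THE BLOCK THEOREM (one direction): on a balanced `S ⊆ U`, `n_S` is constant on each coset `cH`, `c ∈ {1,5,7,11}`. -/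
theorem n_const_of_balanced (S : Finset ℕ) (hS : S ⊆ U) (hb : Balanced S) :
    ∀ c ∈ creps, ∀ t ∈ coset c, nS S t = nS S c := by
  intro c hc t ht
  obtain ⟨i, hi, hci⟩ := creps_mem c hc
  obtain ⟨a, ha, hta⟩ := coset_mem c hc t ht
  have key : ∀ b < 3, nS S ((coset c).getD b 0) = nS S ((coset c).getD (b + 1) 0) := by
    intro b hb'
    obtain ⟨h1, h2⟩ := coset_src_dst i hi b hb'
    rw [← hci] at h1 h2
    rw [← h1, ← h2]
    exact n_src_dst S hS hb (3 * i + b) (by omega)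
  have k0 : nS S ((coset c).getD 0 0) = nS S ((coset c).getD 1 0) := key 0 (by omega)
  have k1 : nS S ((coset c).getD 1 0) = nS S ((coset c).getD 2 0) := key 1 (by omega)
  have k2 : nS S ((coset c).getD 2 0) = nS S ((coset c).getD 3 0) := key 2 (by omega)
  have h0 : nS S ((coset c).getD a 0) = nS S ((coset c).getD 0 0) := by
    interval_cases a
    · rfl
    · exact k0.symm
    · rw [← k1, ← k0]
    · rw [← k2, ← k1, ← k0]
  rw [hta, h0, coset_head c hc]

/-! ### The block theorem, both directions -/

/-- Each `c ∈ creps` lies in its own coset. -/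
theorem creps_mem_coset : ∀ c ∈ creps, c ∈ coset c := by decide +kernel

/-- The converse: if `n_S` is constant on each coset `cH`, `c ∈ creps`, then `S ⊆ U` is balanced. -/
theorem balanced_of_n_const (S : Finset ℕ) (hS : S ⊆ U)
    (h : ∀ c ∈ creps, ∀ t ∈ coset c, nS S t = nS S c) : Balanced S := by
  rw [balanced_iff_sig]
  intro k hk
  rw [sig_eq_sum_R S hS k hk]
  have hz : ∀ c ∈ creps, ((coset c).map (fun t => nS S t * eps (k * t))).sum = 0 := by
    intro c hc
    have hmap : (coset c).map (fun t => nS S t * eps (k * t)) =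
        (coset c).map (fun t => nS S c * eps (k * t)) := by
      apply List.map_congr_left
      intro t ht
      rw [h c hc t ht]
    rw [hmap, List.sum_map_mul_left, coset_sig c hc k hk, mul_zero]
  unfold Rf
  rw [List.sum_toFinset _ R_facts.1, R_eq_cosets, List.map_flatten, List.sum_flatten]
  apply List.sum_eq_zero
  intro x hx
  simp only [List.map_map, List.mem_map, Function.comp] at hx
  obtain ⟨c, hc, rfl⟩ := hx
  exact hz c hc

/-- THE BLOCK THEOREM: `S ⊆ U` is balanced iff `n_S` is constant on each coset `cH`, `c ∈ {1, 5, 7, 11}`. -/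
theorem balanced_iff_n_const (S : Finset ℕ) (hS : S ⊆ U) :
    Balanced S ↔ ∀ c ∈ creps, ∀ t ∈ coset c, nS S t = nS S c :=
  ⟨n_const_of_balanced S hS, balanced_of_n_const S hS⟩

/-- On the block of `c`, `S` is a union of conjugate pairs. -/
abbrev PairsOn (S : Finset ℕ) (c : ℕ) : Prop := ∀ t ∈ coset c, (t ∈ S ↔ conj t ∈ S)

/-- On the block of `c`, `S` is exactly the coset `cH`. -/
abbrev CosetOn (S : Finset ℕ) (c : ℕ) : Prop := ∀ t ∈ coset c, t ∈ S ∧ conj t ∉ S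

/-- On the block of `c`, `S` is exactly the conjugate coset `−cH`. -/
abbrev ConjCosetOn (S : Finset ℕ) (c : ℕ) : Prop := ∀ t ∈ coset c, t ∉ S ∧ conj t ∈ S

/-- `n_S` takes the values `−1, 0, 1`. -/
theorem nS_cases (S : Finset ℕ) (t : ℕ) : nS S t = -1 ∨ nS S t = 0 ∨ nS S t = 1 := by
  unfold nS; split_ifs <;> simp

/-- THE BLOCK THEOREM in set form: `S ⊆ U` is balanced iff on each of the four blocks it is a union of
conjugate pairs, or the coset `cH`, or the coset `−cH`. -/
theorem balanced_iff_blocks (S : Finset ℕ) (hS : S ⊆ U) :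
    Balanced S ↔ ∀ c ∈ creps, PairsOn S c ∨ CosetOn S c ∨ ConjCosetOn S c := by
  rw [balanced_iff_n_const S hS]
  constructor
  · intro h c hc
    have hc' := h c hc
    rcases nS_cases S c with h0 | h0 | h0
    · right; right
      intro t ht
      have := hc' t ht
      rw [h0] at this
      unfold nS at this
      by_cases h1 : t ∈ S <;> by_cases h2 : conj t ∈ S <;> simp_all
    · left
      intro t ht
      have := hc' t ht
      rw [h0] at this
      unfold nS at this
      by_cases h1 : t ∈ S <;> by_cases h2 : conj t ∈ S <;> simp_all
    · right; left
      intro t ht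
      have := hc' t ht
      rw [h0] at this
      unfold nS at this
      by_cases h1 : t ∈ S <;> by_cases h2 : conj t ∈ S <;> simp_all
  · intro h c hc t ht
    have hcc := creps_mem_coset c hc
    rcases h c hc with h1 | h1 | h1
    · have a := h1 t ht; have b := h1 c hcc
      unfold nS
      by_cases ht' : t ∈ S <;> by_cases hc' : c ∈ S <;> simp [ht', hc', a.mp, b.mp, a.not.mp, b.not.mp]
    · obtain ⟨a1, a2⟩ := h1 t ht; obtain ⟨b1, b2⟩ := h1 c hcc
      unfold nS; simp [a1, a2, b1, b2]
    · obtain ⟨a1, a2⟩ := h1 t ht; obtain ⟨b1, b2⟩ := h1 c hcc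
      unfold nS; simp [a1, a2, b1, b2]

end HodgeRepro0.P5AprimeCensus
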